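import Summits.Ventures.PercRepro.S2CoreFifteen
import Summits.Ventures.PercRepro.S2PhiFourteenFive

/-!
# PercRepro — THE CORANK-`≥ 43` CORE THEOREM AT LEVEL `5` AT RANK `14`, AND THE KEY CELL (p7, gen 12; sub-claim S2; the `p = 14` row)

S2CoreFifteen's argument at `p = 14`: the sizes `6 ≤ s ≤ 13` have rank `< 14`, so `Σ_{s=6}^{13} C(n, s) ≤ #Y + #{r ≤ 5}`
(**`choose_sum_six_thirteen_le_midCount_add`**); the rank-`≤ 5` sets number `≤ 16460·C(n, 5)` on every `e`-free core with
`n ≥ 10` (`ncard_eRk_le_five_le_of_free`, S2CoreFifteen). Two uses: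
* **`c025_fourteen_of_topCount_key`** — THE KEY CELL: any bound `#U(14, 5) ≤ U` with `380·U + 148140·C(n, 5) ≤ 9·Σ_{s=6}^{13} C(n, s)`
  gives `RLS M 14 5` (`Φ(14, 5) = 380/9`, S2PhiFourteenFive) — the tail-free cell form for the coranks `28 … 42`;
* **`c025_core_five_at_fourteen_big`** — corank `≥ 43`: `#U ≤ C(n, 5)·2^{14}` (`f(5) ≤ 19`) and the sum key
  `2^{19}·16750·C(n, 5) ≤ C(19, 14)·Σ_{s=6}^{13} C(n, s)` at `n₀ = 57` (room `1.07`; at `n = 56` it FAILS, `0.92`), propagated by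
  `key_sum_of_base` (`16750 ≥ (2^{33} + 16460·11628)/2^{19} = 16749.1`). Axioms: standard.
-/

open scoped Matroid

namespace PercRepro

namespace ThmN

open Set

variable {α : Type}

/-- `Σ_{s=6}^{14} C(53, s)`, decided. -/
theorem sum_choose_fiftyseven_six_thirteen : ∑ s ∈ Finset.Icc 6 13, (57).choose s = 3394223396958 := by
  decide

/-- The sum key at `p = 14`, `q = 5`, `K = 16750`, `n₀ = 57`: one numeral (room `1.07`). -/
theorem key_sum_fourteen_five_q5_base :
    2 ^ (14 + 5) * 16750 * (57).choose 5 ≤ (14 + 5).choose 14 * ∑ s ∈ Finset.Icc 6 13, (57).choose s := by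
  rw [sum_choose_fiftyseven_six_thirteen]
  norm_num [Nat.choose]

/-- **`Σ_{s=6}^{13} C(n, s) ≤ #Y(14, 5) + #{r ≤ 5}`**: an `s`-subset with `6 ≤ s ≤ 13` has rank `< 14`; it is in `Y` unless
its rank is `≤ 5`. -/
theorem choose_sum_six_thirteen_le_midCount_add (M : Matroid α) [M.Finite] :
    ∑ s ∈ Finset.Icc 6 13, M.ground_finite.toFinset.card.choose s ≤
      Matroid.midCount M 14 5 + {X : Set α | X ⊆ M.E ∧ M.eRk X ≤ 5}.ncard := by
  have hE : (M.ground_finite.toFinset : Set α) = M.E := Set.Finite.coe_toFinset _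
  rw [← ncard_subsets_ncard_mem M.ground_finite.toFinset (Finset.Icc 6 13)]
  unfold Matroid.midCount
  refine le_trans (Set.ncard_le_ncard ?_ ?_) (Set.ncard_union_le _ _)
  · intro X hX
    have hXE : X ⊆ M.E := by rw [← hE]; exact hX.1
    have hXfin : X.Finite := M.ground_finite.subset hXE
    have hXc := Finset.mem_Icc.1 hX.2
    by_cases h5 : M.eRk X ≤ 5
    · exact Or.inr ⟨hXE, h5⟩
    · refine Or.inl ⟨hXE, lt_of_not_ge h5, ?_⟩
      calc M.eRk X ≤ X.encard := M.eRk_le_encard X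
        _ = (X.ncard : ℕ∞) := by rw [← hXfin.cast_ncard_eq]
        _ < ((14 : ℕ) : ℕ∞) := by exact_mod_cast (show X.ncard < 14 by omega)
  · exact (M.ground_finite.finite_subsets.subset (fun X hX => hX.1)).union
      (M.ground_finite.finite_subsets.subset (fun X hX => hX.1))

/-- **THE KEY CELL AT `p = 14`**: a bound `#U(14, 5) ≤ U` with `380·U + 148140·C(n, 5) ≤ 9·Σ_{s=6}^{13} C(n, s)` gives
`RLS M 14 5` on the `e`-free core with `n ≥ 10` (`Φ(14, 5) = 380/9`; `#Y ≥ Σ_{s=6}^{13} C(n, s) − #{r ≤ 5}`;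
`#{r ≤ 5} ≤ 16460·C(n, 5)`, so `6·#Y ≥ 6·Σ − 98760·C(n, 5) ≥ 389·U ≥ 389·#U`). -/
theorem c025_fourteen_of_topCount_key (M : Matroid α) [M.Finite] (hn10 : 10 ≤ M.E.ncard)
    (hfree : ∀ e ∈ M.E, ∃ A ⊆ M.E \ {e}, e ∉ M.closure A ∧ e ∉ M.closure ((M.E \ {e}) \ A))
    (U : ℚ) (hU : (Matroid.topCount M 14 5 : ℚ) ≤ U)
    (hkey : 380 * U + 148140 * (M.E.ncard.choose 5 : ℚ) ≤
      9 * ((∑ s ∈ Finset.Icc 6 13, M.E.ncard.choose s : ℕ) : ℚ)) :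
    RLS M 14 5 := by
  classical
  have hEcard : M.ground_finite.toFinset.card = M.E.ncard := by
    rw [Set.ncard_eq_toFinset_card _ M.ground_finite]
  have hY := choose_sum_six_thirteen_le_midCount_add M
  rw [hEcard] at hY
  have hA := ncard_eRk_le_five_le_of_free M hn10 hfree
  have hYq : ((∑ s ∈ Finset.Icc 6 13, M.E.ncard.choose s : ℕ) : ℚ) ≤
      (Matroid.midCount M 14 5 : ℚ) + ({X : Set α | X ⊆ M.E ∧ M.eRk X ≤ 5}.ncard : ℚ) := by
    exact_mod_cast hY
  have hAq : ({X : Set α | X ⊆ M.E ∧ M.eRk X ≤ 5}.ncard : ℚ) ≤ 16460 * (M.E.ncard.choose 5 : ℚ) := by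
    exact_mod_cast hA
  have hU0 : (0 : ℚ) ≤ (Matroid.topCount M 14 5 : ℚ) := by positivity
  rw [RLS_iff, S2.phiK_fourteen_five]
  linarith

/-- **The `e`-free core at level `5`, rank `14`, every corank `≥ 43`** (`f(5) ≤ 19`): `#U ≤ C(n, 5)·2^{14}`,
`#Y ≥ Σ_{s=6}^{13} C(n, s) − #{r ≤ 5}`, `#{r ≤ 5} ≤ 16460·C(n, 5)`, and the sum key from `n₀ = 57`. -/
theorem c025_core_five_at_fourteen_big (M : Matroid α) [M.Finite] (hbig : 14 + 42 < M.E.ncard)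
    (hfree : ∀ e ∈ M.E, ∃ A ⊆ M.E \ {e}, e ∉ M.closure A ∧ e ∉ M.closure ((M.E \ {e}) \ A)) : RLS M 14 5 := by
  classical
  set n := M.E.ncard with hn_def
  have hEcard : M.ground_finite.toFinset.card = n := by
    rw [hn_def, Set.ncard_eq_toFinset_card _ M.ground_finite]
  have hBq' : ∀ X ⊆ M.E, M.eRk X ≤ 5 → X.ncard ≤ 19 := fun X hX hr =>
    ncard_le_nineteen_of_eRk_le_five_of_free M hfree hX hr
  -- (U): every rank-`5` set has `≤ 19` points
  have hU : Matroid.topCount M 14 5 ≤ n.choose 5 * 2 ^ (19 - 5) := by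
    calc Matroid.topCount M 14 5 ≤ Matroid.levelCount M 5 := Matroid.topCount_le_levelCount_bot 14 5
      _ = {X : Set α | X ⊆ M.E ∧ M.eRk X = 5}.ncard := rfl
      _ ≤ n.choose 5 * 2 ^ (19 - 5) := by rw [← hEcard]; exact ncard_eRk_eq_le_choose_mul_of_bound M 5 19 hBq'
  have hA := ncard_eRk_le_five_le_of_free M (by omega) hfree
  -- (Y): the sizes `6 … 14`
  have hY := choose_sum_six_thirteen_le_midCount_add M
  rw [hEcard] at hY
  -- the key, propagated from `n₀ = 57`
  have key := key_sum_of_base 14 5 16750 ((14 + 5).choose 14) 57 (Finset.Icc 6 13)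
    (fun s hs => by rw [Finset.mem_Icc] at hs; omega) (by norm_num)
  have hkey := key key_sum_fourteen_five_q5_base n (by omega)
  -- the arithmetic in `ℚ`
  have hΦ := phiK_le_two_pow_div 14 5
  rw [Nat.choose_symm_add] at hΦ
  have hU0 : (0 : ℚ) ≤ (Matroid.topCount M 14 5 : ℚ) := by positivity
  have hUq : (Matroid.topCount M 14 5 : ℚ) ≤ (n.choose 5 : ℚ) * 16384 := by
    have h := hU
    rw [show (19 : ℕ) - 5 = 14 from rfl, show (2 : ℕ) ^ 14 = 16384 from rfl] at h
    exact_mod_cast h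
  have hAq : ({X : Set α | X ⊆ M.E ∧ M.eRk X ≤ 5}.ncard : ℚ) ≤ 16460 * (n.choose 5 : ℚ) := by
    exact_mod_cast hA
  have hYq : ((∑ s ∈ Finset.Icc 6 13, n.choose s : ℕ) : ℚ) ≤
      (Matroid.midCount M 14 5 : ℚ) + ({X : Set α | X ⊆ M.E ∧ M.eRk X ≤ 5}.ncard : ℚ) := by
    exact_mod_cast hY
  have hc : (14 + 5).choose 14 = 11628 := by decide
  have hc' : (14 + 5).choose 5 = 11628 := by decide
  rw [hc] at hkey
  have hkeyq : (8781824000 : ℚ) * (n.choose 5 : ℚ) ≤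
      11628 * ((∑ s ∈ Finset.Icc 6 13, n.choose s : ℕ) : ℚ) := by
    have h : 8781824000 * n.choose 5 ≤ 11628 * ∑ s ∈ Finset.Icc 6 13, n.choose s := by
      have e : 2 ^ (14 + 5) * 16750 = 8781824000 := by norm_num
      rw [e] at hkey
      exact hkey
    exact_mod_cast h
  rw [hc'] at hΦ
  have hΦq : phiK 14 5 ≤ (524288 : ℚ) / 11628 := by
    have e : (2 : ℚ) ^ (14 + 5) = 524288 := by norm_num
    rw [e] at hΦ
    exact_mod_cast hΦ
  rw [RLS_iff]
  have hpos : (0 : ℚ) ≤ (n.choose 5 : ℚ) := by positivity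
  have hΦU : phiK 14 5 * (Matroid.topCount M 14 5 : ℚ) ≤
      (524288 : ℚ) / 11628 * ((n.choose 5 : ℚ) * 16384) := mul_le_mul hΦq hUq hU0 (by positivity)
  refine hΦU.trans ?_
  rw [show (524288 : ℚ) / 11628 * ((n.choose 5 : ℚ) * 16384) = (8589934592 * (n.choose 5 : ℚ)) / 11628 by ring,
    div_le_iff₀ (by norm_num : (0 : ℚ) < 11628)]
  linarith [hkeyq, hYq, hAq, hpos]

end ThmN

end PercRepro
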